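import Summits.Ventures.HodgeRepro2.Defs
import Summits.Ventures.HodgeRepro2.Dictionary
import Summits.Ventures.HodgeRepro2.Levels
import Summits.Ventures.HodgeRepro2.Instance

/-! # HodgeRepro2 — existence of Theorem 8.1 data over every CM field

Blind re-derivation cell `pub-hodge-repro2`, seat p1 (fifth definitions file).  Sources as in `Defs.lean`:
[Sh79] Shimura, J. Math. Soc. Japan 31 (1979), §4 and Thm 8.1 (p. 588).

Contents (§14): the hypotheses of [Sh79] Theorem 8.1 with `m = 3` (the compact Picard modular surface when
`[K:Q] > 2`) can be met over EVERY CM field `K` and for EVERY distinguished embedding `τ_1 : K → ℂ`: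
a purely imaginary `δ ≠ 0` with `τ_1 ∈ Φ_δ` exists (`exists_imaginary_mem_cmType`), a totally real `a` with
`τ_1(a) < 0` and `τ(a) > 0` at all embeddings `τ ∉ {τ_1, τ̄_1}` exists by weak approximation at the infinite
places (`exists_signElement`, from Mathlib's `NumberField.InfinitePlace.denseRange_algebraMap_pi`), and a full
lattice exists (`exists_isFullLattice`); hence `∃ D : Thm81Data K 2, D.τ = τ_1` (`exists_thm81Data`), with
`T = δ · diag(1, 1, a)` of signature `(2,1)` at `τ_1` and positive definite at the other members of `Φ_δ`
(`Thm81Data.ofSignElement`).  This discharges the "a hermitian space of the required signatures exists"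
side condition of the instantiation by an explicit construction.  §15 records `U(δh) = U(h)` and the level
`Γ_1(𝔠) ∩ Γ_0(𝔭𝔮)` of [DR15] Prop. 3.6 together with the shape of that proposition's conclusion. -/

namespace Summit.Ventures.HodgeRepro2

open Matrix NumberField
open scoped ComplexOrder

/-! ## 14. Existence of the data -/

section Existence

variable (K : Type*) [Field K] [NumberField K] [IsCMField K]

/-- A CM field contains a non-zero purely imaginary element (`δ^ρ = -δ`). -/
theorem exists_imaginary_ne_zero : ∃ δ : K, star δ = -δ ∧ δ ≠ 0 := by
  have h := NumberField.IsCMField.complexConj_ne_one K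
  have hx : ∃ x : K, NumberField.IsCMField.complexConj K x ≠ x := by
    by_contra hcon
    exact h (AlgEquiv.ext fun x => Classical.byContradiction fun hx => hcon ⟨x, hx⟩)
  obtain ⟨x, hx⟩ := hx
  refine ⟨x - star x, ?_, ?_⟩
  · rw [star_sub, star_star, neg_sub]
  · intro h0
    apply hx
    exact (sub_eq_zero.1 h0).symm

/-- For every embedding `τ_1` there is a purely imaginary `δ ≠ 0` with `τ_1 ∈ Φ_δ`, i.e. `-i τ_1(δ) > 0`. -/
theorem exists_imaginary_mem_cmType (τ₁ : K →+* ℂ) :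
    ∃ δ : K, star δ = -δ ∧ δ ≠ 0 ∧ τ₁ ∈ cmTypeOfImaginary K δ := by
  obtain ⟨δ₀, hδ₀, h0⟩ := exists_imaginary_ne_zero K
  by_cases h : τ₁ ∈ cmTypeOfImaginary K δ₀
  · exact ⟨δ₀, hδ₀, h0, h⟩
  · refine ⟨-δ₀, by rw [star_neg, hδ₀, neg_neg], neg_ne_zero.2 h0, ?_⟩
    rcases isCMType_cmTypeOfImaginary K hδ₀ h0 τ₁ with ⟨h1, _⟩ | ⟨h1, _⟩
    · exact absurd h1 h
    · have hre := re_eq_zero_of_star_eq_neg K hδ₀ τ₁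
      simp only [cmTypeOfImaginary, Set.mem_setOf_eq, ComplexEmbedding.conjugate_coe_eq] at h1 ⊢
      rw [map_neg]
      simp only [Complex.mul_re, Complex.neg_re, Complex.neg_im, Complex.I_re, Complex.I_im,
        Complex.conj_re, Complex.conj_im] at h1 ⊢
      linarith

omit [IsCMField K] in
/-- Full `Z`-lattices exist in `K^1_m` (the `Z`-span of a `Q`-basis). -/
theorem exists_isFullLattice (m : ℕ) : ∃ 𝔪 : Submodule ℤ (Fin m → K), IsFullLattice K 𝔪 := by
  let b := Module.Free.chooseBasis ℚ (Fin m → K)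
  refine ⟨Submodule.span ℤ (Set.range b), Module.Finite.span_of_finite ℤ (Set.finite_range b), ?_⟩
  rw [Submodule.span_span_of_tower ℤ ℚ, b.span_eq]

/-- Weak approximation at the infinite places, with prescribed signs: for every non-vanishing integer-valued
function `s` on the infinite places of `K` there is a totally real `a ∈ K` (`a^ρ = a`) with
`sign (Re τ(a)) = sign (s (mk τ))` for every embedding `τ`.  (Take `x ∈ K` within distance `1` of `s v` at
every place `v`, by `NumberField.InfinitePlace.denseRange_algebraMap_pi`, and put `a = (x + x^ρ)/2`.) -/
theorem exists_signElement_of_signs (s : InfinitePlace K → ℤ) (hs : ∀ v, s v ≠ 0) :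
    ∃ a : K, star a = a ∧ ∀ τ : K →+* ℂ, 0 < (s (InfinitePlace.mk τ) : ℝ) * (τ a).re := by
  classical
  -- the evaluation maps are continuous on `WithAbs`
  have hcont : ∀ v : InfinitePlace K,
      Continuous fun y : WithAbs v.1 => v.embedding (WithAbs.ofAbs y) := by
    intro v
    have hiso : Isometry (v.embedding.comp (WithAbs.equiv v.1).toRingHom) :=
      AddMonoidHomClass.isometry_of_norm _ fun y => by
        rw [WithAbs.norm_eq_apply_ofAbs]
        exact InfinitePlace.norm_embedding_eq v _
    exact hiso.continuous
  let U : Set ((v : InfinitePlace K) → WithAbs v.1) :=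
    ⋂ v, {y | ‖v.embedding (WithAbs.ofAbs (y v)) - ((s v : ℤ) : ℂ)‖ < 1}
  have hU : IsOpen U := by
    refine isOpen_iInter_of_finite fun v => ?_
    exact isOpen_lt (((hcont v).comp (continuous_apply v)).sub continuous_const).norm continuous_const
  have hne : U.Nonempty := by
    refine ⟨fun v => WithAbs.toAbs v.1 ((s v : ℤ) : K), ?_⟩
    simp only [U, Set.mem_iInter, Set.mem_setOf_eq, map_intCast, sub_self, norm_zero, zero_lt_one,
      implies_true]
  obtain ⟨x, hx⟩ := (InfinitePlace.denseRange_algebraMap_pi K).exists_mem_open hU hne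
  have key : ∀ v : InfinitePlace K, ‖v.embedding x - ((s v : ℤ) : ℂ)‖ < 1 := by
    intro v
    have := Set.mem_iInter.1 hx v
    simpa [Pi.algebraMap_apply, WithAbs.algebraMap_right_apply] using this
  -- the real part of `τ x` is within `1` of `s (mk τ)`, for every embedding `τ`
  have hre : ∀ τ : K →+* ℂ, |(τ x).re - (s (InfinitePlace.mk τ) : ℝ)| < 1 := by
    intro τ
    have h1 := key (InfinitePlace.mk τ)
    have h2 : ‖τ x - ((s (InfinitePlace.mk τ) : ℤ) : ℂ)‖ < 1 := by
      rcases InfinitePlace.embedding_mk_eq τ with h | h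
      · rwa [h] at h1
      · rw [h, ComplexEmbedding.conjugate_coe_eq] at h1
        have : (starRingEnd ℂ) (τ x) - ((s (InfinitePlace.mk τ) : ℤ) : ℂ) =
            (starRingEnd ℂ) (τ x - ((s (InfinitePlace.mk τ) : ℤ) : ℂ)) := by
          rw [map_sub, map_intCast]
        rwa [this, Complex.norm_conj] at h1
    calc |(τ x).re - (s (InfinitePlace.mk τ) : ℝ)|
        = |(τ x - ((s (InfinitePlace.mk τ) : ℤ) : ℂ)).re| := by
          simp [Complex.sub_re, Complex.intCast_re]
      _ ≤ ‖τ x - ((s (InfinitePlace.mk τ) : ℤ) : ℂ)‖ := Complex.abs_re_le_norm _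
      _ < 1 := h2
  -- `a = (x + x^ρ)/2` is totally real with `Re τ(a) = Re τ(x)`
  have hreal : ∀ τ : K →+* ℂ, (τ ((x + star x) / 2)).re = (τ x).re := by
    intro τ
    have hconj : τ (star x) = (starRingEnd ℂ) (τ x) :=
      NumberField.IsCMField.complexEmbedding_complexConj K τ x
    rw [map_div₀, map_add, hconj, Complex.add_conj, map_ofNat, Complex.ofReal_mul, Complex.ofReal_ofNat,
      mul_div_cancel_left₀ _ two_ne_zero, Complex.ofReal_re]
  refine ⟨(x + star x) / 2, ?_, ?_⟩
  · rw [star_div₀, star_add, star_star, star_ofNat, add_comm]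
  · intro τ
    rw [hreal τ]
    have h1 := abs_sub_lt_iff.1 (hre τ)
    rcases lt_or_gt_of_ne (hs (InfinitePlace.mk τ)) with h | h
    · have h' : (s (InfinitePlace.mk τ) : ℝ) ≤ -1 := by exact_mod_cast (show s (InfinitePlace.mk τ) ≤ -1 by omega)
      exact mul_pos_of_neg_of_neg (by linarith) (by linarith [h1.1])
    · have h' : (1 : ℝ) ≤ s (InfinitePlace.mk τ) := by exact_mod_cast (show 1 ≤ s (InfinitePlace.mk τ) by omega)
      exact mul_pos (by linarith) (by linarith [h1.2])

/-- Weak approximation, the shape needed for a Picard datum: for every embedding `τ_1` there is a totally real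
`a ∈ K` with `Re τ_1(a) < 0` and `Re τ(a) > 0` for every embedding `τ ∉ {τ_1, τ̄_1}`. -/
theorem exists_signElement (τ₁ : K →+* ℂ) :
    ∃ a : K, star a = a ∧ (τ₁ a).re < 0 ∧
      ∀ τ : K →+* ℂ, τ ≠ τ₁ → τ ≠ ComplexEmbedding.conjugate τ₁ → 0 < (τ a).re := by
  classical
  let s : InfinitePlace K → ℤ := fun v => if v = InfinitePlace.mk τ₁ then -1 else 1
  have hs : ∀ v, s v ≠ 0 := by
    intro v
    simp only [s]
    split_ifs <;> norm_num
  obtain ⟨a, ha, hsign⟩ := exists_signElement_of_signs K s hs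
  refine ⟨a, ha, ?_, ?_⟩
  · have := hsign τ₁
    simp only [s, if_true, Int.cast_neg, Int.cast_one, neg_mul, one_mul, neg_pos] at this
    exact this
  · intro τ hτ hτ'
    have hne' : InfinitePlace.mk τ ≠ InfinitePlace.mk τ₁ := by
      intro h
      rcases InfinitePlace.mk_eq_iff.1 h with h | h
      · exact hτ h
      · apply hτ'
        rw [← h]
        exact (star_star τ).symm
    have := hsign τ
    simp only [s, hne', if_false, Int.cast_one, one_mul] at this
    exact this

/-- For every CM type `Φ` of `K` there is a purely imaginary `δ ≠ 0` whose sign type is exactly `Φ`: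
`Φ_δ = {τ | -i τ(δ) > 0} = Φ` (multiply a fixed purely imaginary `δ₀` by a totally real `a` whose signs at
the places are chosen by weak approximation). -/
theorem exists_imaginary_cmType_eq (Φ : Set (K →+* ℂ)) (hΦ : IsCMType K Φ) :
    ∃ δ : K, star δ = -δ ∧ δ ≠ 0 ∧ cmTypeOfImaginary K δ = Φ := by
  classical
  obtain ⟨δ₀, hδ₀, h0⟩ := exists_imaginary_ne_zero K
  let s : InfinitePlace K → ℤ := fun v =>
    (if 0 < (-Complex.I * v.embedding δ₀).re then 1 else -1) * (if v.embedding ∈ Φ then 1 else -1)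
  have hs : ∀ v, s v ≠ 0 := by
    intro v
    simp only [s]
    split_ifs <;> norm_num
  obtain ⟨a, ha, hsign⟩ := exists_signElement_of_signs K s hs
  have haim : ∀ τ : K →+* ℂ, (τ a).im = 0 := by
    intro τ
    have := NumberField.IsCMField.complexEmbedding_complexConj K τ a
    rw [show NumberField.IsCMField.complexConj K a = star a from rfl, ha] at this
    have := congrArg Complex.im this
    simp only [Complex.conj_im] at this
    linarith
  have hδre : ∀ τ : K →+* ℂ, (τ δ₀).re = 0 := re_eq_zero_of_star_eq_neg K hδ₀
  have hprod : ∀ τ : K →+* ℂ, (-Complex.I * τ (δ₀ * a)).re = (-Complex.I * τ δ₀).re * (τ a).re := by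
    intro τ
    rw [map_mul]
    simp [Complex.mul_re, Complex.mul_im, haim τ, hδre τ]
  have hne0 : ∀ τ : K →+* ℂ, (-Complex.I * τ δ₀).re ≠ 0 := by
    intro τ hz
    apply h0
    apply τ.injective
    rw [map_zero]
    refine Complex.ext (hδre τ) ?_
    simpa [Complex.mul_re, hδre τ] using hz
  -- `s` at the place of `τ`, expressed through `τ` itself (the conjugate embedding flips both signs)
  have hsτ : ∀ τ : K →+* ℂ, (s (InfinitePlace.mk τ) : ℝ) =
      (if 0 < (-Complex.I * τ δ₀).re then 1 else -1) * (if τ ∈ Φ then 1 else -1) := by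
    intro τ
    rcases InfinitePlace.embedding_mk_eq τ with h | h
    · simp only [s, h]
      push_cast
      rfl
    · have e1 : (-Complex.I * (ComplexEmbedding.conjugate τ) δ₀).re = -(-Complex.I * τ δ₀).re := by
        rw [ComplexEmbedding.conjugate_coe_eq]
        simp [Complex.mul_re, hδre τ]
      have e2 : ComplexEmbedding.conjugate τ ∈ Φ ↔ τ ∉ Φ := by
        rcases hΦ τ with ⟨h1, h2⟩ | ⟨h1, h2⟩
        · exact ⟨fun h => absurd h h2, fun h => absurd h1 h⟩
        · exact ⟨fun _ => h2, fun _ => h1⟩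
      simp only [s, h]
      rw [e1]
      by_cases hpos : 0 < (-Complex.I * τ δ₀).re <;> by_cases hmem : τ ∈ Φ
      · rw [if_neg (not_lt.2 (by linarith)), if_neg (fun h' => (e2.1 h') hmem), if_pos hpos, if_pos hmem]
        push_cast
        ring
      · rw [if_neg (not_lt.2 (by linarith)), if_pos (e2.2 hmem), if_pos hpos, if_neg hmem]
        push_cast
        ring
      · have hneg : (-Complex.I * τ δ₀).re < 0 := lt_of_le_of_ne (not_lt.1 hpos) (hne0 τ)
        rw [if_pos (by linarith), if_neg (fun h' => (e2.1 h') hmem), if_neg hpos, if_pos hmem]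
        push_cast
        ring
      · have hneg : (-Complex.I * τ δ₀).re < 0 := lt_of_le_of_ne (not_lt.1 hpos) (hne0 τ)
        rw [if_pos (by linarith), if_pos (e2.2 hmem), if_neg hpos, if_neg hmem]
        push_cast
        ring
  refine ⟨δ₀ * a, ?_, ?_, ?_⟩
  · rw [star_mul, hδ₀, ha, mul_neg, mul_comm]
  · intro h
    obtain ⟨τ⟩ : Nonempty (K →+* ℂ) := inferInstance
    have := hsign τ
    rcases mul_eq_zero.1 h with h | h
    · exact h0 h
    · rw [h, map_zero, Complex.zero_re, mul_zero] at this
      exact lt_irrefl _ this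
  · ext τ
    simp only [cmTypeOfImaginary, Set.mem_setOf_eq]
    rw [hprod τ]
    have hst := hsign τ
    rw [hsτ τ] at hst
    by_cases hpos : 0 < (-Complex.I * τ δ₀).re <;> by_cases hmem : τ ∈ Φ
    · rw [if_pos hpos, if_pos hmem, one_mul, one_mul] at hst
      exact ⟨fun _ => hmem, fun _ => mul_pos hpos hst⟩
    · rw [if_pos hpos, if_neg hmem] at hst
      have hlt : (τ a).re < 0 := by nlinarith
      exact ⟨fun h => absurd (pos_of_mul_pos_right h hpos.le) (not_lt.2 hlt.le), fun h => absurd h hmem⟩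
    · have hneg : (-Complex.I * τ δ₀).re < 0 := lt_of_le_of_ne (not_lt.1 hpos) (hne0 τ)
      rw [if_neg hpos, if_pos hmem] at hst
      have hlt : (τ a).re < 0 := by nlinarith
      exact ⟨fun _ => hmem, fun _ => mul_pos_of_neg_of_neg hneg hlt⟩
    · have hneg : (-Complex.I * τ δ₀).re < 0 := lt_of_le_of_ne (not_lt.1 hpos) (hne0 τ)
      rw [if_neg hpos, if_neg hmem] at hst
      have hgt : 0 < (τ a).re := by nlinarith
      exact ⟨fun h => absurd (neg_of_mul_pos_right h hneg.le) (not_lt.2 hgt.le), fun h => absurd h hmem⟩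

/-- The hypotheses of [Sh79] Theorem 8.1 with `m = 3` are satisfiable over every CM field `K`, for every
distinguished embedding `τ_1`: there is a datum `D : Thm81Data K 2` with `D.τ = τ_1` (namely
`T = δ · diag(1, 1, a)` with `δ` purely imaginary, `τ_1 ∈ Φ_δ`, and `a` a sign element from weak
approximation). -/
theorem exists_thm81Data (τ₁ : K →+* ℂ) : ∃ D : Thm81Data K 2, D.τ = τ₁ := by
  obtain ⟨δ, hδ, h0, hτ₁⟩ := exists_imaginary_mem_cmType K τ₁
  obtain ⟨a, ha, hneg, hpos⟩ := exists_signElement K τ₁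
  obtain ⟨𝔪, h𝔪⟩ := exists_isFullLattice K 3
  refine ⟨Thm81Data.ofSignElement K δ a hδ h0 ha τ₁ hτ₁ hneg ?_ 𝔪 h𝔪, rfl⟩
  intro τ hτ hne
  refine hpos τ hne ?_
  intro hc
  rcases isCMType_cmTypeOfImaginary K hδ h0 τ₁ with ⟨_, h2⟩ | ⟨_, h2⟩
  · exact h2 (hc ▸ hτ)
  · exact h2 hτ₁

/-- Consequently the face instance is never vacuous: for every CM field `K`, every vertex `T i` of a face and
every `τ_1 ∈ T i` there is a Theorem 8.1 datum with distinguished embedding `τ_1` (its CM type is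
`Φ_δ ∋ τ_1`, which is `T i` exactly when `δ` is chosen accordingly — see `Thm81Data.ofSignElement`). -/
theorem exists_thm81Data_tau_mem (Φ : Set (K →+* ℂ)) (τ₁ : K →+* ℂ) (hτ₁ : τ₁ ∈ Φ) :
    ∃ D : Thm81Data K 2, D.τ = τ₁ ∧ D.τ ∈ Φ := by
  obtain ⟨D, hD⟩ := exists_thm81Data K τ₁
  exact ⟨D, hD, hD ▸ hτ₁⟩

/-- For every CM type `Φ` and every `τ_1 ∈ Φ` there is a Theorem 8.1 datum with `m = 3`, CM type exactly `Φ`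
and distinguished embedding `τ_1`: the face instance `FaceInstance` is never vacuous. -/
theorem exists_thm81Data_cmType (Φ : Set (K →+* ℂ)) (hΦ : IsCMType K Φ) (τ₁ : K →+* ℂ) (hτ₁ : τ₁ ∈ Φ) :
    ∃ D : Thm81Data K 2, D.Φ = Φ ∧ D.τ = τ₁ := by
  obtain ⟨δ, hδ, h0, hΦδ⟩ := exists_imaginary_cmType_eq K Φ hΦ
  obtain ⟨a, ha, hneg, hpos⟩ := exists_signElement K τ₁
  obtain ⟨𝔪, h𝔪⟩ := exists_isFullLattice K 3
  have hτ₁' : τ₁ ∈ cmTypeOfImaginary K δ := hΦδ ▸ hτ₁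
  refine ⟨Thm81Data.ofSignElement K δ a hδ h0 ha τ₁ hτ₁' hneg ?_ 𝔪 h𝔪, hΦδ, rfl⟩
  intro τ hτ hne
  refine hpos τ hne ?_
  intro hc
  rcases isCMType_cmTypeOfImaginary K hδ h0 τ₁ with ⟨_, h2⟩ | ⟨_, h2⟩
  · exact h2 (hc ▸ hτ)
  · exact h2 hτ₁'

/-- Every vertex of a rank-four face carries Theorem 8.1 data for each of its members. -/
theorem exists_thm81Data_of_isWeilFace (T : Fin 4 → Set (K →+* ℂ)) (hT : IsWeilFace K T) (i : Fin 4)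
    (τ₁ : K →+* ℂ) (hτ₁ : τ₁ ∈ T i) : ∃ D : Thm81Data K 2, D.Φ = T i ∧ D.τ = τ₁ :=
  exists_thm81Data_cmType K (T i) (hT.1 i) τ₁ hτ₁

end Existence


/-! ## 15. The level of [DR15] Prop. 3.6 in this vocabulary -/

section DRLevel

variable (K : Type*) [Field K] [NumberField K] [IsCMField K]

/-- `U(δ h) = U(h)`: the unitary group of Shimura's skew-hermitian `T = δ h` is the unitary group of the
hermitian `h` (scalars commute with everything), so the group `G_Q` of [Sh79] (4.1) for `T = δ h` is the
group `G(F)` of [DR15] for `h` (in the row-vector convention of `unitaryGroupOf`). -/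
theorem unitaryGroupOf_hermitianToSkew {m : ℕ} {δ : K} (hδ : δ ≠ 0) (h : Matrix (Fin m) (Fin m) K) :
    unitaryGroupOf K (hermitianToSkew K δ h) = unitaryGroupOf K h := by
  ext α
  show ((α : Matrix (Fin m) (Fin m) K) * (δ • h) * (α : Matrix (Fin m) (Fin m) K)ᴴ = δ • h) ↔
    ((α : Matrix (Fin m) (Fin m) K) * h * (α : Matrix (Fin m) (Fin m) K)ᴴ = h)
  rw [Matrix.mul_smul, Matrix.smul_mul]
  exact (smul_right_injective (Matrix (Fin m) (Fin m) K) hδ).eq_iff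

/-- The image in `U(2,1)` (through the embedding (4.3) at `τ` with frame `Q`) of the congruence subgroup
`Γ_1(𝔠) ∩ Γ_0(𝔭𝔮)` of `G(𝔬)` — the level of [DR15] Prop. 3.6 (`𝔠` = conductor of the Hecke character `λ`,
`𝔭` a prime of `F` split in `M` prime to `𝔠`, `𝔮` a prime of `F` not split in `M` or `𝔮 = 𝔬`; here the ideals
are taken in `𝔒 = 𝓞 K`). -/
noncomputable def drLevelImage (h : Matrix (Fin 3) (Fin 3) K) (τ : K →+* ℂ) (Q : GL (Fin 3) ℂ)
    (𝔠 𝔭 𝔮 : Ideal (𝓞 K)) : Set (Matrix (Fin 3) (Fin 3) ℂ) :=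
  (fun γ : GL (Fin 3) (𝓞 K) =>
      embedAt K τ Q ((integralToGL K γ : GL (Fin 3) K) : Matrix (Fin 3) (Fin 3) K)) ''
    (Gamma1Level K h 𝔠 ⊓ Gamma0Level K h (𝔭 * 𝔮))

/-- The conclusion of [DR15] Proposition 3.6 ("Then `q(Y_{Γ_1(𝔠) ∩ Γ_0(𝔭𝔮)}) > 2`") in this vocabulary: the
space of closed holomorphic 1-forms on the 2-ball invariant under the level group has dimension `> 2`.  Its
printed hypotheses — `λ` a Hecke character of `M` of weight one (`(weight1)`) whose restriction to `F` is `ω`,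
`𝔠` its conductor, `𝔭` split and prime to `𝔠`, `𝔮` non-split if `W(λ³) = (-1)^d` and `𝔮 = 𝔬` otherwise — are
adelic and are NOT formalised here; this `Prop` records only the shape of the conclusion. -/
def DRProp36Conclusion (h : Matrix (Fin 3) (Fin 3) K) (τ : K →+* ℂ) (Q : GL (Fin 3) ℂ)
    (𝔠 𝔭 𝔮 : Ideal (𝓞 K)) : Prop :=
  2 < irregularity 2 (drLevelImage K h τ Q 𝔠 𝔭 𝔮)

end DRLevel


/-! ## 16. Monotonicity: "the irregularity cannot decrease by going to a finite cover" ([DR15] §2.2) -/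

section Monotone

/-- Forms invariant under a larger set of matrices are invariant under a smaller one. -/
theorem invariantFormSpace_antitone {r : ℕ} {S S' : Set (Matrix (Fin (r + 1)) (Fin (r + 1)) ℂ)}
    (h : S ⊆ S') : invariantFormSpace r S' ≤ invariantFormSpace r S := by
  rintro f ⟨h1, h2, h3⟩
  exact ⟨h1, h2, fun β hβ => h3 β (h hβ)⟩

/-- Passing to a smaller group (a finite cover of the quotient) does not decrease the irregularity, as long
as the larger space of invariant forms is finite-dimensional. -/
theorem irregularity_mono {r : ℕ} {S S' : Set (Matrix (Fin (r + 1)) (Fin (r + 1)) ℂ)} (h : S ⊆ S')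
    [Module.Finite ℂ (invariantFormSpace r S)] : irregularity r S' ≤ irregularity r S :=
  Submodule.finrank_mono (invariantFormSpace_antitone h)

/-- The intersection over the four vertices of a face: forms invariant under each of four groups are
invariant under their intersection — the level `Γ_face = ⋂_i Γ_{Φ_i}` of the transfer. -/
theorem invariantFormSpace_le_iInter {r : ℕ} (S : Fin 4 → Set (Matrix (Fin (r + 1)) (Fin (r + 1)) ℂ))
    (i : Fin 4) : invariantFormSpace r (S i) ≤ invariantFormSpace r (⋂ j, S j) :=
  invariantFormSpace_antitone (Set.iInter_subset S i)

end Monotone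

end Summit.Ventures.HodgeRepro2
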